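import Literature.MathematicalPhysics.QuantumFieldTheory.Balaban1983to89.B9Thm311AdjointAtLetters
import Literature.MathematicalPhysics.QuantumFieldTheory.Balaban1983to89.B9Thm314GpFlatTorusGeometry
import Literature.MathematicalPhysics.QuantumFieldTheory.Balaban1983to89.Node00.OpsYGauge

/-!
# `Balaban1983to89.B9Thm311DeltaPrimeSymm` — (3.24)'s Δ′_a(U) as the SYMMETRIC operator `Δ_U + Σ_j a_j(L^jη)^{−2} Q′_j(U)\*Q′_j(U)`:
# the averaging transporter with the adjoint leg `U(Γ_{c,z})⁻¹`, and the proof that this Δ′_a(U) — and the covariant Laplacian — are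
# symmetric for the real trace pairing at unitary transporters (the repair of located finding R7 on def-Y's `avgTrY`, as a drop-in letter)

T. Bałaban, *Propagators for lattice gauge theories in a background field*, Commun. Math. Phys. **99** (1985) 389–434
[`Balaban1985BackgroundPropagators`, "B9"]; [4] = *Propagators … II*, Commun. Math. Phys. **96** (1984) 223–250 [`Balaban1984PropagatorsII`].

statement-level skeleton of published theorems with citation tags; proofs where landed; nothing here is a claim about the
Yang–Mills mass gap

THE PRINTED LOCI (verbatim).  p. 392: *"The adjoints are taken with respect to natural L² scalar products for functions with values in N × N
hermitian matrices. The inner product for these matrices is defined by X·Y = tr XY."*, (3.8) *"(D\*A)(x) = Σ_μ η⁻¹(R(U(x, x − ηe_μ))A(x − ηe_μ, x)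
− A(x, x + ηe_μ))"*;  p. 393, (3.18)–(3.19) (Q′(U) averaging along `U(Γ_{y,x})`, Q′\*(U) its adjoint);  p. 394, (3.24): Δ′_a(U) through its quadratic
form `‖∇_UΦ‖² + Σ_j a_j(L^jη)^{−2} Σ_y |(Q′_j(U)Φ)(y)|²`;  p. 416, Thm 3.11: *"It is a symmetric and invertible operator"*;  [4] (2.13)–(2.14) p. 225.

WHY THIS FILE (located finding R7 of seat n06-j, 2026-08-27).  def-Y's letter `Node00.deltaPrimeAY par U = lapSL U + kernelTrOpY (avgCoeffY) (avgTrY par U)`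
(`OpsYDeltaPrimeA`) transports the averaging term by `avgTrY par U z w = par U z c · par U c w` (c the corner of the common block): the value is
averaged INTO c along `U(Γ_{c,w})` (as in (3.18) and in def-Y's own `QpY`) but spread BACK to z along `U(Γ_{z,c})`, where the adjoint Q′\*(U) of
(3.19)∕(3.24) transports by `U(Γ_{c,z})⁻¹` (as in def-Y's own `QpsY`).  The taxicab table `parSY` is not inverse-symmetric (`U(Γ_{z,c})·U(Γ_{c,z})` is a
plaquette holonomy in general), so that letter is print's Δ′_a(U) only up to an O(α₀) holonomy and is NOT a symmetric operator for non-flat U — while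
print's Theorem 3.11 (and [3] p. 25, and (3.25)'s orthogonal projection) USE the symmetry.  THIS FILE types the drop-in repair and proves what
print asserts: `avgTrY'` (first factor inverted), `deltaPrimeAY' par U := lapSL U + kernelTrOpY (avgCoeffY) (avgTrY' par U)` (same `U = 1` face
`deltaPrimeAY'_one` as def-Y's, and EQUAL to def-Y's letter on inverse-symmetric transporter tables), and — the content — `lapSL_isSymmTr` (the
covariant Laplacian is symmetric for the trace pairing at unitary U: summation by parts `B9Eq39Adjoint.sum_covD_mul` + `(R(V)A)\* = R(V)A\*`),
`kernelTrOpY_isSymmTr` (a transported kernel operator with symmetric kernel and inverse-consistent unitary transporters is symmetric) and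
★ `deltaPrimeAY'_isSymmTr` ∕ `deltaPrimeAY'_parSY_isSymmTr` (the repaired Δ′_a(U) IS symmetric at unitary ∕ G-valued transporters).  TWO
adoption routes, both served: (J) `avgTrY := avgTrY'` (one token; every `_one` lemma unchanged); (S) — def-Y's choice (INTENT-9, director №138:
deprecate-and-add, no in-place edit) — a v4 record over an INVERSE-SYMMETRIC site transporter `parSymY` (`U(Γ_{z,z′}) = U(Γ_{z′,z})⁻¹` by
construction), on which def-Y's unchanged `deltaPrimeAY` EQUALS `deltaPrimeAY'` (`deltaPrimeAY'_eq_of_inv_symm`), so `deltaPrimeAY'_isSymmTr` IS the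
symmetry of the v4 letter and the clause `symm0` of the row-17 schema `Inputs311Y` becomes a theorem at the v4 letters of record.

* §1 `avgTrY'`, `avgTrY'_one`, ★ `deltaPrimeAY'`, `deltaPrimeAY'_apply`, `deltaPrimeAY'_one`, `deltaPrimeAY'_eq_of_inv_symm`.
* §1b `avgTrY'_gaugeY`, `deltaPrimeAY'_cov` (def-Y's gauge covariance (3.31)–(3.32) survives the repair — the v2.1 proofs).
* §2 (𝔸 = M_N(ℂ)) `conjTranspose_R`, `trIP_one_eq`, `isSymmTr_add`, `conjTranspose_cdS`, ★ `lapSL_isSymmTr`, ★ `kernelTrOpY_isSymmTr`.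
* §3 `avgCoeffY_eq_ite`, `avgCoeffY_symm`, `cornerY_eq_of_avgCoeffY_ne_zero`, `avgTrY'_swap`, ★★ `deltaPrimeAY'_isSymmTr`, ★ `deltaPrimeAY'_parSY_isSymmTr`,
  `deltaPrimeAY_parSY_one_isSymmTr` (def-Y's own letter IS symmetric at U = 1).
* §4 (v1.1) ★★ `deltaPrimeAY_isSymmTr_of_inv_symm` — route (S) packaged: def-Y's UNCHANGED `deltaPrimeAY i par U` is symmetric on any
  inverse-symmetric `G`-valued table (`par := parSymY`).

HONEST SCOPE.  Finite-dimensional non-commutative algebra (summation by parts over bijective shifts, trace cyclicity, unitary conjugation) on def-Y's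
and NODE 00's objects; this file does NOT edit def-Y's record (one declarer) — it supplies the repaired letter and its symmetry theorem for
adoption.  Nothing of [B9] is asserted; NOT a node discharge, NOT summit progress; count-neutral; nothing continuum, nothing about the mass gap.
Cell `pub-ymgap` (HUMAN RULING D-0062), Track A node N06 [B9], seat `pub-ymgap-dag-n06-j` (harness re-seat gen 6), 2026-08-27.
-/

namespace Literature.MathematicalPhysics.QuantumFieldTheory.Balaban1983to89.B9Thm311DeltaPrimeSymm

open Literature.MathematicalPhysics.QuantumFieldTheory.Balaban1983to89
open B9Thm311ReadingCoords B9Thm311ReadingAtLetters B9Thm311AdjointAtLetters Node00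
open B6KLevelCensusIndexV1 B6Geom246MultiLevelBox B9PinMembersKLevelV1 B7Prop2SpecialUnitary B4Reflection242 B6MultiLevelBoxOperator
  B6MultiLevelTorusOperator
open scoped Matrix

noncomputable section

/-! ## §1 The repaired averaging transporter and Δ′_a(U) -/

section Letter

variable {d ℓ : ℕ} {hd : 1 ≤ d + 1} {hL : Odd (ℓ + 1) ∧ 1 < ℓ + 1} {b₀ b₁ : ℝ}
variable {𝔸 : Type} [NormedRing 𝔸] [NormedAlgebra ℂ 𝔸] [CompleteSpace 𝔸]
variable (i : KIdx d ℓ hd hL b₀ b₁)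

/-- ★ **THE AVERAGING TRANSPORTER OF (3.24) WITH THE ADJOINT LEG**: `U(Γ_{c,z})⁻¹ · U(Γ_{c,w})` through the corner `c` of the common block — the
value at `w` is transported to `c` as in Q′(U) ((3.18)) and back to `z` as in the ADJOINT Q′(U)\* ((3.19)), i.e. by the inverse of the `z → c`
transporter (def-Y's `avgTrY` uses `U(Γ_{z,c})` for the second leg). [cite: Balaban1985BackgroundPropagators, (3.18)–(3.19) p.393, (3.24) p.394] -/
def avgTrY' (par : SiteParY 𝔸 i) (U : CfgY 𝔸 i) (z w : SiteY i) : 𝔸ˣ :=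
  (par U (cornerY i (levY i z) z) z)⁻¹ * par U (cornerY i (levY i z) z) w

/-- at `U = 1` (transporters `= 1`) the repaired averaging transporter is `1`. [cite: Balaban1985BackgroundPropagators, Cor. 3.5 p.407 (U = 1), bookkeeping] -/
theorem avgTrY'_one (par : SiteParY 𝔸 i) (hpar : ∀ z w, par (fun _ _ => 1) z w = 1) (z w : SiteY i) :
    avgTrY' i par (fun _ _ => 1) z w = 1 := by
  rw [avgTrY', hpar, hpar, inv_one, mul_one]

/-- ★★ **(3.24)'s `Δ′_a(U) = Δ_U + Σ_j a_j(L^jη)^{−2} Q′_j(U)\*1_{Λ_j}Q′_j(U)` WITH THE ADJOINT LEG** — def-Y's covariant Laplacian plus the averaging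
kernel transported by `avgTrY'`. [cite: Balaban1985BackgroundPropagators, (3.24) p.394; Balaban1984PropagatorsII, (2.13)–(2.14) p.225] -/
def deltaPrimeAY' (par : SiteParY 𝔸 i) (U : CfgY 𝔸 i) : (SiteY i → 𝔸) →ₗ[ℂ] (SiteY i → 𝔸) :=
  lapSL i U + kernelTrOpY (avgCoeffY i) (avgTrY' i par U)

/-- the repaired Δ′_a(U), evaluated. [cite: Balaban1985BackgroundPropagators, (3.24) p.394, bookkeeping] -/
theorem deltaPrimeAY'_apply (par : SiteParY 𝔸 i) (U : CfgY 𝔸 i) (Λ : SiteY i → 𝔸) (z : SiteY i) :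
    deltaPrimeAY' i par U Λ z = lapS i U Λ z + ∑ w, ((avgCoeffY i z w : ℝ) : ℂ) • B9Eq39Adjoint.R (avgTrY' i par U z w) (Λ w) := rfl

/-- **THE PRINTED `U = 1` CLAUSE IS UNCHANGED**: at the trivial configuration the repaired operator is the lift of NODE 00's matrix `Δ′_a` (`mlOpT`),
exactly as def-Y's `deltaPrimeAY_one`. [cite: Balaban1985BackgroundPropagators, p.395 («It coincides with Δ_a in (2.19) if U = 1»); Balaban1984PropagatorsII, (2.13)–(2.14) p.225] -/
theorem deltaPrimeAY'_one (par : SiteParY 𝔸 i) (hpar : ∀ z w, par (fun _ _ => 1) z w = 1) :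
    deltaPrimeAY' i par (fun _ _ => 1) = liftOpY 𝔸 (mlOpT (toKT i).NB ℓ (toKT i).k (toKT i).D.lev (aPrinted ℓ 1)) := by
  have htr : avgTrY' i par (fun _ _ => 1) = fun _ _ => (1 : 𝔸ˣ) := funext fun z => funext fun w => avgTrY'_one i par hpar z w
  rw [deltaPrimeAY', htr, kernelTrOpY_one, lapSL_one, mlOpT_eq_perLapT_add_avgCoeffY, liftOpY_add]

/-- on an INVERSE-SYMMETRIC transporter table (`U(Γ_{z,z′}) = U(Γ_{z′,z})⁻¹`, e.g. any flat configuration) the repaired operator IS def-Y's letter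
`deltaPrimeAY`. [cite: Balaban1985BackgroundPropagators, (3.5) p.391 («U(x,x′) = U⁻¹(x′,x)»), (3.24) p.394] -/
theorem deltaPrimeAY'_eq_of_inv_symm (par : SiteParY 𝔸 i) (U : CfgY 𝔸 i) (h : ∀ z z' : SiteY i, par U z z' = (par U z' z)⁻¹) :
    deltaPrimeAY' i par U = deltaPrimeAY i par U := by
  have htr : avgTrY' i par U = avgTrY i par U := by
    funext z w
    rw [avgTrY', avgTrY, ← h]
  rw [deltaPrimeAY', deltaPrimeAY, htr]

end Letter

/-! ## §1b The repaired letter keeps def-Y's gauge covariance (3.31)–(3.32) (the v2.1 proof of `OpsYGauge.avgTrY_gaugeY`) -/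

section Gauge

variable {d ℓ : ℕ} {hd : 1 ≤ d + 1} {hL : Odd (ℓ + 1) ∧ 1 < ℓ + 1} {b₀ b₁ : ℝ}
variable {𝔸 : Type} [NormedRing 𝔸] [NormedAlgebra ℂ 𝔸] [CompleteSpace 𝔸]
variable (i : KIdx d ℓ hd hL b₀ b₁) (g : GaugeY 𝔸 i) (U : CfgY 𝔸 i)

/-- the repaired averaging transporter transforms as a contour variable `z ← w` under a gauge transformation (def-Y's `avgTrY_gaugeY`, re-proved for
the adjoint leg: `(g_c τ_{cz} g_z⁻¹)⁻¹ (g_c τ_{cw} g_w⁻¹) = g_z (τ_{cz}⁻¹ τ_{cw}) g_w⁻¹`). [cite: Balaban1985BackgroundPropagators, (3.28) p.395, (3.24) p.394] -/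
theorem avgTrY'_gaugeY {parS : SiteParY 𝔸 i} (hS : IsGaugeLawS i parS) (z w : SiteY i) :
    avgTrY' i parS (gaugeY i g U) z w = gSiteY i g z * avgTrY' i parS U z w * (gSiteY i g w)⁻¹ := by
  rw [avgTrY', avgTrY', hS, hS]
  simp only [mul_inv_rev, inv_inv, mul_assoc, inv_mul_cancel_left]

/-- ★ (3.31)–(3.32) FOR THE REPAIRED `Δ′_a(U)`: `R(g)·Δ′_a(U) = Δ′_a(U^g)·R(g)` — def-Y's `deltaPrimeAY_cov` verbatim with `avgTrY'_gaugeY`.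
[cite: Balaban1985BackgroundPropagators, (3.24) p.394, (3.31)–(3.32) p.395] -/
theorem deltaPrimeAY'_cov {parS : SiteParY 𝔸 i} (hS : IsGaugeLawS i parS) :
    Intw (conjY (gSiteY i g)) (conjY (gSiteY i g)) (deltaPrimeAY' i parS U) (deltaPrimeAY' i parS (gaugeY i g U)) := by
  unfold deltaPrimeAY'
  refine (lapSL_cov i g U).add ?_
  rw [kernelTrOpY_eq_trLiftY, kernelTrOpY_eq_trLiftY]
  exact intw_trLiftY _ _ _ _ _ fun z w _ => avgTrY'_gaugeY i g U hS z w

end Gauge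

/-! ## §2 Symmetry for the trace pairing at `𝔸 = M_N(ℂ)`: the covariant Laplacian and transported kernel operators -/

section Symm

open scoped Matrix.Norms.L2Operator

variable {N : ℕ}

/-- at a unitary `V`, conjugation commutes with the adjoint action: `(R(V)A)\* = R(V)A\*`. [cite: Balaban1985BackgroundPropagators, (3.1) p.390 + p.392 (hermitian values)] -/
theorem conjTranspose_R (V : (Matrix (Fin N) (Fin N) ℂ)ˣ) (hV : (V : Matrix (Fin N) (Fin N) ℂ) ∈ unitary (Matrix (Fin N) (Fin N) ℂ))
    (A : Matrix (Fin N) (Fin N) ℂ) : (B9Eq39Adjoint.R V A)ᴴ = B9Eq39Adjoint.R V Aᴴ := by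
  unfold B9Eq39Adjoint.R
  rw [val_inv_eq_conjTranspose V hV, Matrix.conjTranspose_mul, Matrix.conjTranspose_mul, Matrix.conjTranspose_conjTranspose,
    Matrix.mul_assoc]

variable {S : Type} [Fintype S]

/-- the weight-1 trace pairing as one complex trace sum: `⟨Φ, Ψ⟩₁ = Re Σ_s tr(Φ(s)\*Ψ(s))`. [cite: Balaban1985BackgroundPropagators, p.392 (X·Y = tr XY), bookkeeping] -/
theorem trIP_one_eq (Φ Ψ : S → Matrix (Fin N) (Fin N) ℂ) :
    trIP (fun _ => (1 : ℝ)) Φ Ψ = (∑ s, Matrix.trace ((Φ s)ᴴ * Ψ s)).re := by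
  rw [trIP_eq_re_trace, Complex.re_sum]
  simp only [one_mul]

/-- symmetric operators add. [cite: Balaban1985BackgroundPropagators, (3.24) p.394 (a sum of two forms), bookkeeping] -/
theorem isSymmTr_add (w : S → ℝ) {A B : (S → Matrix (Fin N) (Fin N) ℂ) →ₗ[ℂ] (S → Matrix (Fin N) (Fin N) ℂ)} (hA : IsSymmTr w A)
    (hB : IsSymmTr w B) : IsSymmTr w (A + B) := by
  intro Φ Ψ
  have hl : trIP w ((A + B) Φ) Ψ = trIP w (A Φ) Ψ + trIP w (B Φ) Ψ := by
    simp only [trIP, LinearMap.add_apply, Pi.add_apply, Matrix.add_apply, star_add, add_mul, Complex.add_re, Finset.sum_add_distrib,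
      mul_add]
  have hr : trIP w Φ ((A + B) Ψ) = trIP w Φ (A Ψ) + trIP w Φ (B Ψ) := by
    simp only [trIP, LinearMap.add_apply, Pi.add_apply, Matrix.add_apply, mul_add, Complex.add_re, Finset.sum_add_distrib]
  rw [hl, hr, hA, hB]

/-- ★ **A TRANSPORTED KERNEL OPERATOR WITH SYMMETRIC KERNEL AND INVERSE-CONSISTENT UNITARY TRANSPORTERS IS SYMMETRIC** for the trace pairing:
`K(z,w) = K(w,z)`, `T(w,z) = T(z,w)⁻¹` and `T(z,w)` unitary on the support of `K` ⇒ `⟨K♯_TΦ, Ψ⟩ = ⟨Φ, K♯_TΨ⟩` — the shape of (3.24)'s averaging term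
`Σ_j a_j(L^jη)^{−2}Q′_j(U)\*Q′_j(U)`. [cite: Balaban1985BackgroundPropagators, (3.19) p.393, (3.24) p.394] -/
theorem kernelTrOpY_isSymmTr {X : Type} [Fintype X] (K : X → X → ℝ) (T : X → X → (Matrix (Fin N) (Fin N) ℂ)ˣ)
    (hK : ∀ z w, K z w = K w z) (hT : ∀ z w, K z w ≠ 0 → T w z = (T z w)⁻¹)
    (hU : ∀ z w, K z w ≠ 0 → ((T z w : (Matrix (Fin N) (Fin N) ℂ)ˣ) : Matrix (Fin N) (Fin N) ℂ) ∈ unitary (Matrix (Fin N) (Fin N) ℂ)) :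
    IsSymmTr (fun _ => (1 : ℝ)) (kernelTrOpY K T) := by
  intro Φ Ψ
  rw [trIP_eq_re_trace, trIP_eq_re_trace]
  simp only [one_mul]
  have hterm : ∀ z w, K z w * (Matrix.trace ((B9Eq39Adjoint.R (T z w) (Φ w))ᴴ * Ψ z)).re =
      K w z * (Matrix.trace ((Φ w)ᴴ * B9Eq39Adjoint.R (T w z) (Ψ z))).re := by
    intro z w
    by_cases h0 : K z w = 0
    · rw [h0, ← hK z w, h0, zero_mul, zero_mul]
    · rw [trace_conjTranspose_R_mul _ (hU z w h0), ← hT z w h0, hK z w]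
  have hL : ∀ z, (Matrix.trace ((kernelTrOpY K T Φ z)ᴴ * Ψ z)).re =
      ∑ w, K z w * (Matrix.trace ((B9Eq39Adjoint.R (T z w) (Φ w))ᴴ * Ψ z)).re := fun z =>
    re_trace_conjTranspose_trLiftY_mul (Matrix.of K) T Φ (Ψ z) z
  have hR : ∀ w, (Matrix.trace ((Φ w)ᴴ * kernelTrOpY K T Ψ w)).re =
      ∑ z, K w z * (Matrix.trace ((Φ w)ᴴ * B9Eq39Adjoint.R (T w z) (Ψ z))).re := fun w =>
    re_trace_conjTranspose_mul_trLiftY (Matrix.of K) T Ψ (Φ w) w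
  simp_rw [hL, hR, hterm]
  rw [Finset.sum_comm]

/-- `Re tr(B\*A) = Re tr(A\*B)` — the real trace pairing is symmetric. [cite: Balaban1985BackgroundPropagators, p.392 (X·Y = tr XY), bookkeeping] -/
theorem re_trace_conjTranspose_mul_comm (A B : Matrix (Fin N) (Fin N) ℂ) :
    (Matrix.trace (Bᴴ * A)).re = (Matrix.trace (Aᴴ * B)).re := by
  rw [show Bᴴ * A = (Aᴴ * B)ᴴ by rw [Matrix.conjTranspose_mul, Matrix.conjTranspose_conjTranspose], Matrix.trace_conjTranspose]
  exact Complex.conj_re _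

variable {d ℓ : ℕ} {hd : 1 ≤ d + 1} {hL : Odd (ℓ + 1) ∧ 1 < ℓ + 1} {b₀ b₁ : ℝ}
variable (i : KIdx d ℓ hd hL b₀ b₁)

/-- at a unitary-valued configuration, conjugation commutes with the covariant derivative: `(∇_{U,μ}Φ)\* = ∇_{U,μ}(Φ\*)`.
[cite: Balaban1985BackgroundPropagators, (3.3) p.390 + p.392 (hermitian values)] -/
theorem conjTranspose_cdS (U : CfgY (Matrix (Fin N) (Fin N) ℂ) i)
    (hU : ∀ μ x, ((U μ x : (Matrix (Fin N) (Fin N) ℂ)ˣ) : Matrix (Fin N) (Fin N) ℂ) ∈ unitary (Matrix (Fin N) (Fin N) ℂ))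
    (μ : Fin (d + 1)) (Φ : SiteY i → Matrix (Fin N) (Fin N) ℂ) (z : SiteY i) :
    (cdS i U μ Φ z)ᴴ = cdS i U μ (fun w => (Φ w)ᴴ) z := by
  have h' : ((UboxY i U μ z : (Matrix (Fin N) (Fin N) ℂ)ˣ) : Matrix (Fin N) (Fin N) ℂ) ∈ unitary (Matrix (Fin N) (Fin N) ℂ) := hU μ _
  unfold cdS B9Eq39Adjoint.covD
  rw [Matrix.conjTranspose_sub, conjTranspose_R _ h']

/-- **(3.8) FOR THE SESQUILINEAR TRACE PAIRING**: `Σ_z tr(Φ(z)\*(∇\*_{U,μ}G)(z)) = Σ_z tr((∇_{U,μ}Φ)(z)\*G(z))` at a unitary-valued configuration —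
`B9Eq39Adjoint.sum_covD_mul` (exact background, bilinear pairing `tr XY`) read through `(R(V)A)\* = R(V)A\*`. [cite: Balaban1985BackgroundPropagators, (3.8) p.392] -/
theorem sum_trace_mul_cdsS (U : CfgY (Matrix (Fin N) (Fin N) ℂ) i)
    (hU : ∀ μ x, ((U μ x : (Matrix (Fin N) (Fin N) ℂ)ˣ) : Matrix (Fin N) (Fin N) ℂ) ∈ unitary (Matrix (Fin N) (Fin N) ℂ))
    (μ : Fin (d + 1)) (Φ G : SiteY i → Matrix (Fin N) (Fin N) ℂ) :
    ∑ z, Matrix.trace ((Φ z)ᴴ * cdsS i U μ G z) = ∑ z, Matrix.trace ((cdS i U μ Φ z)ᴴ * G z) := by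
  have htr : ∀ a b : Matrix (Fin N) (Fin N) ℂ,
      Matrix.traceAddMonoidHom (Fin N) ℂ (a * b) = Matrix.traceAddMonoidHom (Fin N) ℂ (b * a) := fun a b => Matrix.trace_mul_comm a b
  have h := B9Eq39Adjoint.sum_covD_mul (shiftY i) (UboxY i U) (Matrix.traceAddMonoidHom (Fin N) ℂ) htr μ (fun z => (Φ z)ᴴ) G
  have hl : ∀ z, Matrix.trace ((cdS i U μ Φ z)ᴴ * G z) =
      Matrix.traceAddMonoidHom (Fin N) ℂ (B9Eq39Adjoint.covD (shiftY i) (UboxY i U) μ (fun w => (Φ w)ᴴ) z * G z) := by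
    intro z
    rw [conjTranspose_cdS i U hU μ Φ z]
    rfl
  have hr : ∀ z, Matrix.trace ((Φ z)ᴴ * cdsS i U μ G z) =
      Matrix.traceAddMonoidHom (Fin N) ℂ ((Φ z)ᴴ * B9Eq39Adjoint.covDstar (shiftY i) (UboxY i U) μ G z) := fun z => rfl
  simp_rw [hl, hr]
  exact h.symm

/-- `⟨Φ, Δ_UΨ⟩ = Σ_μ Σ_z tr((∇_μΦ)(z)\*(∇_μΨ)(z))` (the complex trace sum, before taking real parts). [cite: Balaban1985BackgroundPropagators, (3.23) p.395 (⟨λ, Δ_Uλ⟩ = ‖∇_Uλ‖²)] -/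
theorem sum_trace_mul_lapS (U : CfgY (Matrix (Fin N) (Fin N) ℂ) i)
    (hU : ∀ μ x, ((U μ x : (Matrix (Fin N) (Fin N) ℂ)ˣ) : Matrix (Fin N) (Fin N) ℂ) ∈ unitary (Matrix (Fin N) (Fin N) ℂ))
    (Φ Ψ : SiteY i → Matrix (Fin N) (Fin N) ℂ) :
    ∑ z, Matrix.trace ((Φ z)ᴴ * lapS i U Ψ z) = ∑ μ : Fin (d + 1), ∑ z, Matrix.trace ((cdS i U μ Φ z)ᴴ * cdS i U μ Ψ z) := by
  have h1 : ∀ z, Matrix.trace ((Φ z)ᴴ * lapS i U Ψ z) = ∑ μ : Fin (d + 1), Matrix.trace ((Φ z)ᴴ * cdsS i U μ (cdS i U μ Ψ) z) := by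
    intro z
    rw [show lapS i U Ψ z = ∑ μ : Fin (d + 1), cdsS i U μ (cdS i U μ Ψ) z from rfl, Matrix.mul_sum, Matrix.trace_sum]
  simp_rw [h1]
  rw [Finset.sum_comm]
  exact Finset.sum_congr rfl fun μ _ => sum_trace_mul_cdsS i U hU μ Φ (cdS i U μ Ψ)

/-- ★ **THE COVARIANT LAPLACIAN `Δ_U = Σ_μ ∇\*_{U,μ}∇_{U,μ}` IS SYMMETRIC** for the trace pairing at a unitary-valued configuration (both sides are
`Re Σ_μ Σ_z tr((∇_μΦ)(z)\*(∇_μΨ)(z))`). [cite: Balaban1985BackgroundPropagators, (3.8) p.392, (3.23) p.395] -/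
theorem lapSL_isSymmTr (U : CfgY (Matrix (Fin N) (Fin N) ℂ) i)
    (hU : ∀ μ x, ((U μ x : (Matrix (Fin N) (Fin N) ℂ)ˣ) : Matrix (Fin N) (Fin N) ℂ) ∈ unitary (Matrix (Fin N) (Fin N) ℂ)) :
    IsSymmTr (fun _ => (1 : ℝ)) (lapSL i U) := by
  intro Φ Ψ
  rw [trIP_one_eq, trIP_one_eq]
  simp only [lapSL_apply]
  have hflip : (∑ z, Matrix.trace ((lapS i U Φ z)ᴴ * Ψ z)).re = (∑ z, Matrix.trace ((Ψ z)ᴴ * lapS i U Φ z)).re := by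
    rw [Complex.re_sum, Complex.re_sum]
    exact Finset.sum_congr rfl fun z _ => (re_trace_conjTranspose_mul_comm _ _).symm
  rw [hflip, sum_trace_mul_lapS i U hU Ψ Φ, sum_trace_mul_lapS i U hU Φ Ψ, Complex.re_sum, Complex.re_sum]
  refine Finset.sum_congr rfl fun μ _ => ?_
  rw [Complex.re_sum, Complex.re_sum]
  exact Finset.sum_congr rfl fun z _ => re_trace_conjTranspose_mul_comm _ _

end Symm

/-! ## §3 The repaired Δ′_a(U) is symmetric at unitary ∕ G-valued transporters -/

section Repaired

open scoped Matrix.Norms.L2Operator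

variable {d ℓ : ℕ} {hd : 1 ≤ d + 1} {hL : Odd (ℓ + 1) ∧ 1 < ℓ + 1} {b₀ b₁ : ℝ} {N : ℕ}
variable (i : KIdx d ℓ hd hL b₀ b₁)

/-- NODE 00's averaging coefficient is the block indicator of `𝔅`: `levC_{lev z}·[blkOf w = blkOf z]`. [cite: Balaban1984PropagatorsII, (2.14) p.225, dictionary] -/
theorem avgCoeffY_eq_ite (z w : SiteY i) :
    avgCoeffY i z w = if blkOf i.D.toDomains w = blkOf i.D.toDomains z then levC d ℓ (aPrinted ℓ 1) (levY i z) else 0 :=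
  B9Thm314GpFlatTorusGeometry.avgK_lev_eq (toKT i).D _ z w

/-- the averaging coefficient is symmetric (sites of one block of `𝔅` have one level). [cite: Balaban1984PropagatorsII, (2.13)–(2.14) p.225 (a quadratic form)] -/
theorem avgCoeffY_symm (z w : SiteY i) : avgCoeffY i z w = avgCoeffY i w z := by
  rw [avgCoeffY_eq_ite, avgCoeffY_eq_ite]
  by_cases h : blkOf i.D.toDomains w = blkOf i.D.toDomains z
  · rw [if_pos h, if_pos h.symm]
    have hl : levY i z = levY i w := by
      change i.D.toDomains.lev z.1 = i.D.toDomains.lev w.1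
      rw [lev_eq_of_blkOf_eq i.D.toDomains rfl, lev_eq_of_blkOf_eq i.D.toDomains rfl, h]
    rw [hl]
  · rw [if_neg h, if_neg (Ne.symm h)]

/-- the reference corner of the averaging transporter is the corner of the block of `𝔅` containing the site. [cite: Balaban1985BackgroundPropagators, (3.19) p.393, dictionary] -/
theorem cornerY_levY_eq (z : SiteY i) : cornerY i (levY i z) z = blkCornerY i (blkOf i.D.toDomains z) :=
  Subtype.ext (funext fun _ => rfl)

/-- on the support of the coefficient the two sites share their reference corner. [cite: Balaban1985BackgroundPropagators, (3.19) p.393, bookkeeping] -/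
theorem cornerY_eq_of_avgCoeffY_ne_zero {z w : SiteY i} (h : avgCoeffY i z w ≠ 0) : cornerY i (levY i w) w = cornerY i (levY i z) z := by
  rw [avgCoeffY_eq_ite] at h
  have hb : blkOf i.D.toDomains w = blkOf i.D.toDomains z := by
    by_contra hne
    exact h (if_neg hne)
  rw [cornerY_levY_eq, cornerY_levY_eq, hb]

variable {𝔸 : Type} [NormedRing 𝔸] [NormedAlgebra ℂ 𝔸] [CompleteSpace 𝔸] in
/-- on the support of the coefficient the repaired transporter is INVERSE-CONSISTENT: `τ(w, z) = τ(z, w)⁻¹`. [cite: Balaban1985BackgroundPropagators, (3.5) p.391, (3.24) p.394] -/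
theorem avgTrY'_swap (par : SiteParY 𝔸 i) (U : CfgY 𝔸 i) {z w : SiteY i} (h : avgCoeffY i z w ≠ 0) :
    avgTrY' i par U w z = (avgTrY' i par U z w)⁻¹ := by
  rw [avgTrY', avgTrY', cornerY_eq_of_avgCoeffY_ne_zero i h, mul_inv_rev, inv_inv]

/-- ★★ **THE REPAIRED Δ′_a(U) IS SYMMETRIC** for the trace pairing whenever the site transporters and the configuration take values in a subgroup
`G ≤ U(N)` (print p.416: *"It is a symmetric … operator"*; (3.24) is a quadratic form). [cite: Balaban1985BackgroundPropagators, (3.24) p.394, Thm 3.11 p.416] -/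
theorem deltaPrimeAY'_isSymmTr {G : Subgroup (Matrix (Fin N) (Fin N) ℂ)ˣ} (hG : G ≤ B7Prop2Explicit.unitaryUnits (Matrix (Fin N) (Fin N) ℂ))
    (par : SiteParY (Matrix (Fin N) (Fin N) ℂ) i) (U : CfgY (Matrix (Fin N) (Fin N) ℂ) i)
    (hpar : ∀ z w : SiteY i, par U z w ∈ G) (hU : ∀ μ x, U μ x ∈ G) :
    IsSymmTr (fun _ => (1 : ℝ)) (deltaPrimeAY' i par U) := by
  refine isSymmTr_add _ (lapSL_isSymmTr i U fun μ x => hG (hU μ x)) ?_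
  refine kernelTrOpY_isSymmTr (avgCoeffY i) (avgTrY' i par U) (avgCoeffY_symm i) (fun z w h => avgTrY'_swap i par U h) ?_
  intro z w _
  exact hG (G.mul_mem (G.inv_mem (hpar _ _)) (hpar _ _))

/-- ★ **AT def-Y's TAXICAB TRANSPORTERS `parSY`**: for a `G`-valued configuration, `G ≤ U(N)` (e.g. `G = SU(N)` under (3.35)), the repaired Δ′_a(U) is
symmetric — the clause `symm0` of the row-17 schema at letters with `avgTrY := avgTrY'`. [cite: Balaban1985BackgroundPropagators, (3.24) p.394, (3.35) p.396, Thm 3.11 p.416] -/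
theorem deltaPrimeAY'_parSY_isSymmTr {G : Subgroup (Matrix (Fin N) (Fin N) ℂ)ˣ} (hG : G ≤ B7Prop2Explicit.unitaryUnits (Matrix (Fin N) (Fin N) ℂ))
    (U : CfgY (Matrix (Fin N) (Fin N) ℂ) i) (hU : ∀ μ x, U μ x ∈ G) :
    IsSymmTr (fun _ => (1 : ℝ)) (deltaPrimeAY' i (parSY i) U) :=
  deltaPrimeAY'_isSymmTr i hG (parSY i) U (fun z w => parSY_mem i hU z w) hU


/-- **AT `U = 1` def-Y's OWN LETTER IS SYMMETRIC** (all transporters `= 1`, so the table is inverse-symmetric and `deltaPrimeAY = deltaPrimeAY'`): the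
located asymmetry is invisible at the trivial configuration — in particular the row-17 clause `symm0` HOLDS at `U = 1` at the letters of record.
[cite: Balaban1985BackgroundPropagators, p.395 («It coincides with Δ_a in (2.19) if U = 1»), Thm 3.11 p.416] -/
theorem deltaPrimeAY_parSY_one_isSymmTr :
    IsSymmTr (fun _ => (1 : ℝ)) (deltaPrimeAY i (parSY (𝔸 := Matrix (Fin N) (Fin N) ℂ) i) (fun _ _ => 1)) := by
  rw [← deltaPrimeAY'_eq_of_inv_symm i (parSY i) (fun _ _ => 1) (fun z z' => by rw [parSY_one, parSY_one, inv_one])]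
  exact deltaPrimeAY'_parSY_isSymmTr i specialUnitaryUnits_le_unitaryUnits (fun _ _ => 1)
    fun _ _ => (specialUnitaryUnits (Fin N)).one_mem

end Repaired


/-! ## §4 (v1.1) def-Y's UNCHANGED letter on any inverse-symmetric `G`-valued transporter table (route (S): `par := parSymY`) -/

section RouteS

open scoped Matrix.Norms.L2Operator

variable {d ℓ : ℕ} {hd : 1 ≤ d + 1} {hL : Odd (ℓ + 1) ∧ 1 < ℓ + 1} {b₀ b₁ : ℝ} {N : ℕ}
variable (i : KIdx d ℓ hd hL b₀ b₁)

/-- ★★ **ROUTE (S) PACKAGED**: for ANY site transporter table that is INVERSE-SYMMETRIC at `U` (`par U z z′ = (par U z′ z)⁻¹` — def-Y's v4 `parSymY` by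
construction) and `G`-valued with `G ≤ U(N)`, at a `G`-valued configuration def-Y's UNCHANGED letter `deltaPrimeAY i par U` is symmetric for the trace
pairing — the row-17 clause `symm0` at the v4 letters of record, by `deltaPrimeAY'_eq_of_inv_symm` + `deltaPrimeAY'_isSymmTr`.
[cite: Balaban1985BackgroundPropagators, (3.24) p.394, (3.5) p.391, Thm 3.11 p.416] -/
theorem deltaPrimeAY_isSymmTr_of_inv_symm {G : Subgroup (Matrix (Fin N) (Fin N) ℂ)ˣ}
    (hG : G ≤ B7Prop2Explicit.unitaryUnits (Matrix (Fin N) (Fin N) ℂ)) (par : SiteParY (Matrix (Fin N) (Fin N) ℂ) i)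
    (U : CfgY (Matrix (Fin N) (Fin N) ℂ) i) (hinv : ∀ z z' : SiteY i, par U z z' = (par U z' z)⁻¹) (hpar : ∀ z w : SiteY i, par U z w ∈ G)
    (hU : ∀ μ x, U μ x ∈ G) : IsSymmTr (fun _ => (1 : ℝ)) (deltaPrimeAY i par U) := by
  rw [← deltaPrimeAY'_eq_of_inv_symm i par U hinv]
  exact deltaPrimeAY'_isSymmTr i hG par U hpar hU

end RouteS

end

end Literature.MathematicalPhysics.QuantumFieldTheory.Balaban1983to89.B9Thm311DeltaPrimeSymm
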